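import Summits.QuantumFields.YangMills.Theorems.IR.BetaSlopeFloorTransport
import Literature.MathematicalPhysics.QuantumFieldTheory.SpeciesTimeReflection
import Literature.MathematicalPhysics.QuantumLattice.WilsonBlockHeatBathLightCone2

/-!
# Line `beta-slope-floor` (crux `IR`, stmt-QuantumFields-19354): sign-free transport of a RUNNING slope floor

Route `BalabanLadder`, crux `IR`, line `beta-slope-floor` (ideator ym-ir-idea-2), lead prover `ym-ir-line-bsf-p1`.
Skeleton rev 2 of the line lets the unit RUN inside the window (`(c·a(b)·n − K)·R_b ≤ ∂_b R_b`, `b ∈ [β, β+1]`)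
and types the window regularity `κ·a(β) ≤ a(b)` separately (`WindowRegular a`).  Passing from the running floor to
decay in the FROZEN unit `a(β)` by the pointwise replacement `a(b) ≥ κ a(β)` needs the SIGN `R_b ≥ 0` — available
by reflection positivity for slice-diagonal correlators (`Theorems/IR/BetaSlopeFloorTransportRunning.lean`), but
only for one parity of the index for the reflected clauses `c_{ΘA,A}`, `c_{A,ΘA}` of a general species.  This
module removes the sign hypothesis altogether:

* §1 `nonneg_of_running_floor` — NO DOWNWARD CROSSING: if `f` is differentiable on `[β, β+1]`,
  `l(x)·f(x) ≤ f'(x)` there with `l ≤ L` bounded above, and `f(β) ≥ 0`, then `f ≥ 0` on the whole window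
  (fencing argument `image_le_of_deriv_right_lt_deriv_boundary` against the barriers `ε·e^{x−β}`, `ε ↓ 0`, for
  `−e^{−L(x−β)} f`);
* §1 `le_exp_mul_of_running_floor` — hence a running floor with `l₀ ≤ l ≤ L` and an endpoint bound
  `f(β+1) ≤ M`, `M ≥ 0`, give `f(β) ≤ e^{−l₀}·M` WITHOUT any sign assumption on `f` (if `f(β) < 0` the bound is
  free; otherwise §1 makes the frozen floor `l₀ f ≤ f'` valid and the landed `le_exp_mul_of_mul_le_deriv` applies);
* §2 `reflAntipodalDecay_of_windowRegular_of_runningFloor` — for the line: window regularity + the running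
  β-slope floor for the two reflected antipodal clauses of EVERY species (skeleton v3 `ReflSlopeFloor`, δ-unfolded)
  give reflected antipodal decay in units at rate `c·κ` (skeleton `ReflAntipodalDecay`, δ-unfolded), anchored at
  the free end by `|c_{·,·}(S;S)| ≤ 2‖A‖∞²` at `β+1`.  Window regularity also bounds `a` on each window
  (`a(b) ≤ a(β+1)/κ`), which is the `L` of §1.

Group-blind calculus; carries no gap content; nothing here proves the Yang–Mills mass gap (Clay); R4 closes only the
conditional finite-𝕋⁴ rung `BalabanLadder.UV`.
Refs: line card `Cruxes/IR/Lines/beta-slope-floor.md` rev 5; Mathlib `image_le_of_deriv_right_lt_deriv_boundary`.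
-/

set_option autoImplicit false

noncomputable section

open MeasureTheory Filter Topology Set
open Literature.MathematicalPhysics.QuantumFieldTheory Literature.MathematicalPhysics.QuantumLattice

namespace Summit.QuantumFields.YangMills.Cruxes.IR.BetaSlopeFloor

/-! ## §1 Calculus: a running floor cannot push a non-negative function below zero -/

/-- **No downward crossing under a running floor.**  If `f` is differentiable at every point of `[β, β+1]`,
`l x · f x ≤ f' x` there, `l ≤ L` on the window and `0 ≤ f β`, then `0 ≤ f x` for every `x ∈ [β, β+1]`. -/
theorem nonneg_of_running_floor {f : ℝ → ℝ} {β L : ℝ} {l : ℝ → ℝ}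
    (hf : ∀ x ∈ Icc β (β + 1), DifferentiableAt ℝ f x)
    (hfl : ∀ x ∈ Icc β (β + 1), l x * f x ≤ deriv f x)
    (hL : ∀ x ∈ Icc β (β + 1), l x ≤ L) (h0 : 0 ≤ f β) :
    ∀ x ∈ Icc β (β + 1), 0 ≤ f x := by
  -- `g x = e^{-L (x-β)} f x`, `u = -g`; `u' ≤ 0` wherever `u ≥ 0`
  set E : ℝ → ℝ := fun x => Real.exp (-L * (x - β)) with hE
  have hEd : ∀ x, HasDerivAt E (Real.exp (-L * (x - β)) * -L) x := by
    intro x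
    have h1 : HasDerivAt (fun y : ℝ => -L * (y - β)) (-L) x := by
      simpa using ((hasDerivAt_id x).sub_const β).const_mul (-L)
    exact h1.exp
  set u : ℝ → ℝ := fun x => -(E x * f x) with hu
  set u' : ℝ → ℝ := fun x => -(Real.exp (-L * (x - β)) * -L * f x + Real.exp (-L * (x - β)) * deriv f x)
    with hu'
  have hud : ∀ x ∈ Icc β (β + 1), HasDerivAt u (u' x) x := fun x hx =>
    ((hEd x).mul (hf x hx).hasDerivAt).neg
  have huc : ContinuousOn u (Icc β (β + 1)) := fun x hx => (hud x hx).continuousAt.continuousWithinAt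
  -- fencing against `ε e^{x - β}` for every `ε > 0`
  have hfence : ∀ ε : ℝ, 0 < ε → ∀ x ∈ Icc β (β + 1), u x ≤ ε * Real.exp (x - β) := by
    intro ε hε x hx
    have hB : ∀ y, HasDerivAt (fun y => ε * Real.exp (y - β)) (ε * Real.exp (y - β)) y := by
      intro y
      have h1 : HasDerivAt (fun y : ℝ => y - β) 1 y := (hasDerivAt_id y).sub_const β
      simpa using h1.exp.const_mul ε
    refine image_le_of_deriv_right_lt_deriv_boundary huc
      (fun y hy => (hud y (Ico_subset_Icc_self hy)).hasDerivWithinAt) ?_ hB ?_ hx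
    · show u β ≤ ε * Real.exp (β - β)
      simp only [hu, hE, sub_self, mul_zero, Real.exp_zero, one_mul, mul_one]
      linarith
    · intro y hy hcontact
      -- at a contact point `u y = ε e^{y-β} > 0`, so `f y < 0`, so `g' y ≥ 0`, so `u' y ≤ 0 < ε e^{y-β}`
      have hy' : y ∈ Icc β (β + 1) := Ico_subset_Icc_self hy
      have hEpos : 0 < Real.exp (-L * (y - β)) := Real.exp_pos _
      have hupos : 0 < u y := by rw [hcontact]; positivity
      have hfneg : f y < 0 := by
        by_contra hge
        push Not at hge
        have : u y ≤ 0 := by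
          simp only [hu, hE, neg_nonpos]
          exact mul_nonneg hEpos.le hge
        linarith
      have hg' : 0 ≤ Real.exp (-L * (y - β)) * -L * f y + Real.exp (-L * (y - β)) * deriv f y := by
        have key : Real.exp (-L * (y - β)) * -L * f y + Real.exp (-L * (y - β)) * deriv f y =
            Real.exp (-L * (y - β)) * (deriv f y - L * f y) := by ring
        rw [key]
        refine mul_nonneg hEpos.le ?_
        have h1 := hfl y hy'
        have h2 : L * f y ≤ l y * f y := mul_le_mul_of_nonpos_right (hL y hy') hfneg.le
        linarith
      have hu'le : u' y ≤ 0 := by simp only [hu']; linarith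
      exact lt_of_le_of_lt hu'le (by positivity)
  intro x hx
  have hux : u x ≤ 0 := by
    have hpos : 0 < Real.exp (x - β) := Real.exp_pos _
    by_contra hgt
    push Not at hgt
    have h := hfence (u x / (2 * Real.exp (x - β))) (by positivity) x hx
    have : u x / (2 * Real.exp (x - β)) * Real.exp (x - β) = u x / 2 := by
      field_simp
    rw [this] at h
    linarith
  have hEpos : 0 < E x := Real.exp_pos _
  have hEf : 0 ≤ E x * f x := by simp only [hu] at hux; linarith
  exact (mul_nonneg_iff_of_pos_left hEpos).mp hEf

/-- **Sign-free transport of a running floor.**  If `f` is differentiable on `[β, β+1]`, `l x · f x ≤ f' x` there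
with `l₀ ≤ l x ≤ L`, and `f (β+1) ≤ M` with `M ≥ 0`, then `f β ≤ e^{−l₀} · M`.  (If `f β < 0` this is free;
otherwise `f ≥ 0` on the window by `nonneg_of_running_floor`, the frozen floor `l₀ f ≤ f'` holds, and
`le_exp_mul_of_mul_le_deriv` applies.) -/
theorem le_exp_mul_of_running_floor {f : ℝ → ℝ} {β l₀ L M : ℝ} {l : ℝ → ℝ}
    (hf : ∀ x ∈ Icc β (β + 1), DifferentiableAt ℝ f x)
    (hfl : ∀ x ∈ Icc β (β + 1), l x * f x ≤ deriv f x)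
    (hl₀ : ∀ x ∈ Icc β (β + 1), l₀ ≤ l x) (hL : ∀ x ∈ Icc β (β + 1), l x ≤ L)
    (hM : f (β + 1) ≤ M) (hM0 : 0 ≤ M) : f β ≤ Real.exp (-l₀) * M := by
  by_cases h0 : 0 ≤ f β
  · have hnn := nonneg_of_running_floor hf hfl hL h0
    have hfrozen : ∀ x ∈ Icc β (β + 1), l₀ * f x ≤ deriv f x := fun x hx =>
      (mul_le_mul_of_nonneg_right (hl₀ x hx) (hnn x hx)).trans (hfl x hx)
    exact (le_exp_mul_of_mul_le_deriv hf hfrozen).trans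
      (mul_le_mul_of_nonneg_left hM (Real.exp_pos _).le)
  · push Not at h0
    exact h0.le.trans (mul_nonneg (Real.exp_pos _).le hM0)

/-! ## §2 The line: window regularity + running reflected floor ⇒ reflected antipodal decay in units -/

section Line

variable {G : Type} [Group G] [TopologicalSpace G] [IsTopologicalGroup G] [CompactSpace G]
  [MeasurableSpace G] [BorelSpace G]

/-- A running floor for a correlator of two bounded measurable observables on a unit window, with window
regularity `κ a(β) ≤ a(b) ≤ a(β+1)/κ`, transports to the frozen-unit decay
`c_β ≤ e^{K} e^{−cκ a(β) s} · 2 C_A C_B` — no sign of the correlator needed. -/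
theorem latticeConnectedCorr_le_of_running_floor (r : LatticeRep G) (S : ℕ) [NeZero S]
    {A B : LGConfig 4 G → ℝ} (hAm : Measurable A) (hBm : Measurable B) {CA CB : ℝ}
    (hA : ∀ U, |A U| ≤ CA) (hB : ∀ U, |B U| ≤ CB) (n : ℕ) {a : ℝ → ℝ} {β c κ K s aM : ℝ}
    (hc : 0 ≤ c) (hs : 0 ≤ s) (hκa : ∀ b : ℝ, β ≤ b → b ≤ β + 1 → κ * a β ≤ a b)
    (haM : ∀ b : ℝ, β ≤ b → b ≤ β + 1 → a b ≤ aM)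
    (hfl : ∀ b : ℝ, β ≤ b → b ≤ β + 1 →
      (c * a b * s - K) * latticeConnectedCorr r.ρ b S A B n ≤
        deriv (fun b' => latticeConnectedCorr r.ρ b' S A B n) b) :
    latticeConnectedCorr r.ρ β S A B n ≤
      Real.exp K * Real.exp (-(c * κ * a β * s)) * (2 * (CA * CB)) := by
  have h2 : latticeConnectedCorr r.ρ (β + 1) S A B n ≤ 2 * (CA * CB) :=
    (le_abs_self _).trans (WilsonBlockHeatBath.abs_latticeConnectedCorr_le_two_mul r (β + 1) S hA hB n)
  have hCA0 : 0 ≤ CA := le_trans (abs_nonneg _) (hA fun _ => 1)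
  have hCB0 : 0 ≤ CB := le_trans (abs_nonneg _) (hB fun _ => 1)
  have h := le_exp_mul_of_running_floor (f := fun b' => latticeConnectedCorr r.ρ b' S A B n)
    (l := fun b => c * a b * s - K) (l₀ := c * κ * a β * s - K) (L := c * aM * s - K)
    (fun x _ => differentiableAt_latticeConnectedCorr r S hAm hBm hA hB n x)
    (fun x hx => hfl x hx.1 hx.2)
    (fun x hx => by
      have := mul_le_mul_of_nonneg_right
        (mul_le_mul_of_nonneg_left (hκa x hx.1 hx.2) hc) hs
      linarith)
    (fun x hx => by
      have := mul_le_mul_of_nonneg_right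
        (mul_le_mul_of_nonneg_left (haM x hx.1 hx.2) hc) hs
      linarith)
    h2 (by positivity)
  have hexp : Real.exp (-(c * κ * a β * s - K)) = Real.exp K * Real.exp (-(c * κ * a β * s)) := by
    rw [← Real.exp_add]; ring_nf
  rw [hexp] at h
  exact h

/-- **Window regularity + running reflected slope floor ⇒ reflected antipodal decay in units** (skeleton v3
§5, with `WindowRegular`, `ReflSlopeFloor`, `ReflAntipodalDecay` δ-unfolded).  If `κ·a(β) ≤ a(b)` on the unit
windows (`β ≥ β₂ʷ`) and every species `A` has a constant `K_A` with the running floor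
`(c·a(b)·S − K_A)·R_b ≤ ∂_b R_b`, `b ∈ [β, β+1]`, for both reflected antipodal clauses
`R = c_{ΘA,A}(S;S)`, `c_{A,ΘA}(S;S)` (`β ≥ β₂`, `S ≥ S₁ β`), then both clauses decay at the antipode in the frozen
unit: `R_β ≤ e^{K_A}·2‖A‖∞²·e^{−(cκ)·a(β)·S}` for `β ≥ max β₂ β₂ʷ`, `S ≥ S₁ β`.  No reflection-positivity sign is
used (§1). -/
theorem reflAntipodalDecay_of_windowRegular_of_runningFloor (r : LatticeRep G) (a : ℝ → ℝ)
    (hW : ∃ κ β₂ : ℝ, 0 < κ ∧ ∀ β : ℝ, β₂ ≤ β → ∀ b : ℝ, β ≤ b → b ≤ β + 1 → κ * a β ≤ a b)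
    (h : ∃ (c β₂ : ℝ) (S₁ : ℝ → ℕ), 0 < c ∧ ∀ A : YMSpecies G, ∃ K : ℝ, ∀ β : ℝ, β₂ ≤ β →
      ∀ S : ℕ, S₁ β ≤ S → ∀ b : ℝ, β ≤ b → b ≤ β + 1 →
        (c * a b * S - K) * latticeConnectedCorr r.ρ b (2 * S + 1) A.timeReflect.F A.F S ≤
            deriv (fun b' => latticeConnectedCorr r.ρ b' (2 * S + 1) A.timeReflect.F A.F S) b ∧
          (c * a b * S - K) * latticeConnectedCorr r.ρ b (2 * S + 1) A.F A.timeReflect.F S ≤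
            deriv (fun b' => latticeConnectedCorr r.ρ b' (2 * S + 1) A.F A.timeReflect.F S) b) :
    ∃ (c₁ β₂ : ℝ) (S₁ : ℝ → ℕ), 0 < c₁ ∧ ∀ A : YMSpecies G, ∃ C : ℝ, ∀ β : ℝ, β₂ ≤ β →
      ∀ S : ℕ, S₁ β ≤ S →
        latticeConnectedCorr r.ρ β (2 * S + 1) A.timeReflect.F A.F S ≤ C * Real.exp (-(c₁ * a β * S)) ∧
          latticeConnectedCorr r.ρ β (2 * S + 1) A.F A.timeReflect.F S ≤
            C * Real.exp (-(c₁ * a β * S)) := by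
  obtain ⟨κ, βw, hκ, hW⟩ := hW
  obtain ⟨c, β₂, S₁, hc, h⟩ := h
  refine ⟨c * κ, max β₂ βw, S₁, mul_pos hc hκ, fun A => ?_⟩
  obtain ⟨K, hK⟩ := h A
  obtain ⟨CA, hCA⟩ := A.bounded
  have hCA' : ∀ U, |A.timeReflect.F U| ≤ CA := fun U => by simpa using hCA (cfgReflect U)
  refine ⟨Real.exp K * (2 * (CA * CA)), fun β hβ S hS => ?_⟩
  have hβ₂ : β₂ ≤ β := (le_max_left _ _).trans hβ
  have hβw : βw ≤ β := (le_max_right _ _).trans hβ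
  -- window regularity, lower and upper: `κ a β ≤ a b ≤ a (β+1) / κ` on `[β, β+1]`
  have hκa : ∀ b : ℝ, β ≤ b → b ≤ β + 1 → κ * a β ≤ a b := fun b hb1 hb2 => hW β hβw b hb1 hb2
  have haM : ∀ b : ℝ, β ≤ b → b ≤ β + 1 → a b ≤ a (β + 1) / κ := by
    intro b hb1 hb2
    have h1 : κ * a b ≤ a (β + 1) := hW b (hβw.trans hb1) (β + 1) hb2 (by linarith)
    rw [le_div_iff₀ hκ, mul_comm]
    exact h1
  have e1 : Real.exp K * Real.exp (-(c * κ * a β * S)) * (2 * (CA * CA)) =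
      Real.exp K * (2 * (CA * CA)) * Real.exp (-(c * κ * a β * S)) := by ring
  constructor
  · have hres := latticeConnectedCorr_le_of_running_floor r (2 * S + 1) A.timeReflect.measurable
      A.measurable hCA' hCA S (a := a) (β := β) (c := c) (κ := κ) (K := K) (s := S)
      (aM := a (β + 1) / κ) hc.le (Nat.cast_nonneg S) hκa haM
      (fun b hb1 hb2 => (hK β hβ₂ S hS b hb1 hb2).1)
    rw [e1] at hres
    exact hres
  · have hres := latticeConnectedCorr_le_of_running_floor r (2 * S + 1) A.measurable
      A.timeReflect.measurable hCA hCA' S (a := a) (β := β) (c := c) (κ := κ) (K := K) (s := S)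
      (aM := a (β + 1) / κ) hc.le (Nat.cast_nonneg S) hκa haM
      (fun b hb1 hb2 => (hK β hβ₂ S hS b hb1 hb2).2)
    rw [e1] at hres
    exact hres

end Line

end Summit.QuantumFields.YangMills.Cruxes.IR.BetaSlopeFloor

end
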